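import Summits.HodgeConjecture.HodgeConjecture.Theorems.ELineTransportEClassOfSquareHodgeTypePreserving
import Summits.HodgeConjecture.HodgeConjecture.Theses.ELineTransport
import Literature.AlgebraicGeometry.HodgeTheory.HodgeClassOfMorphismDischarge
import Literature.AlgebraicGeometry.HodgeTheory.ComplexGysinCorrespondence
import Literature.AlgebraicGeometry.HodgeTheory.ComplexConjugationHolds
import Literature.AlgebraicGeometry.HodgeTheory.HodgeFiltrationModelsReductionProofs

/-!
# Route ELineTransport · `EClassOfSquareHodge` (stmt-HodgeConjecture-19048) — PROVED, unconditionally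

Piece `X₂` of the BC2 redirect of `IsogenyInvariance` (the direction ⟹ of Varesco 2023, p. 8: "HC for
`X²` ⟺ every element of `End_Hdg(T(X))` is algebraic"): for a projective K3 surface `S`, non-square `m`
and an `E`-structure `J` on `H²(S(ℂ); ℂ)` (rational, `J² = m`, cup-self-adjoint, `+√m` on `H^{2,0}`),
`HodgeConjectureFor 4 (S ⊗ S)` implies that the class of `J` is algebraic: `J = [γ]_*` for some
`γ ∈ algebraicClasses (S ⊗ S) 2`. The landed reduction `eClassOfSquareHodge_of_k3Marking` takes the
marking fact `Huybrechts_K3_marking_exists` (through the marked canonical class `Υ_J`); here the item is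
proved with NO named-fact hypothesis:

* `J` is type-preserving — `EClassOfSquareHodge.isOfHodgeType_map_of_cupSelfAdjoint` (rational,
  cup-self-adjoint, real scalar on `H^{2,0}`; landed, fact-free);
* Voisin I, Lemma 11.41 in the tree's discharged form `exists_hodgeClass_corrAction_eq_smul_holds`: a
  rational type-preserving `J` is `t • γ_*` (`t ≠ 0`) for a RATIONAL class `γ` of type `(2,2)` on
  `S ⊗ S`, for ANY orientation family `μ` (`corrAction μ`, which unfolds — `corrAction_apply` — to the
  item's `pr₁_*(pr₂^* x ∪ γ)`);
* `HodgeConjectureFor 4 (S ⊗ S)` in codimension `2` makes `γ` algebraic, and `t⁻¹ • γ` induces `J`.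

Only `IsSmoothProjective 2 S`, rationality, self-adjointness and the scalar on `H^{2,0}` are used
(`J² = m`, `¬ IsSquare m`, the K3 clauses are idle). No definition, no named-fact hypothesis, no sorry.
Prover seat ring2-b02 (gen 47).

References: Varesco, *Hodge similitudes and the Hodge conjecture for squares of K3 surfaces* (2023), §2
p. 8; Voisin, *Hodge Theory and Complex Algebraic Geometry I*, §11.3.3 Thm. 11.38 and Lemma 11.41.
-/

set_option linter.dupNamespace false

noncomputable section

namespace Summit.HodgeConjecture.HodgeConjecture.Theorems.EClassOfSquareHodge

open scoped Manifold
open CategoryTheory MonoidalCategory CartesianMonoidalCategory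
open Literature.AlgebraicGeometry Literature.AlgebraicGeometry.Motives Literature.AlgebraicGeometry.HodgeTheory
open Literature.AlgebraicTopology.SingularHomology

/-- **`EClassOfSquareHodge` (stmt-HodgeConjecture-19048), PROVED with no named-fact hypothesis**: if the
Hodge conjecture holds for `S ⊗ S` then every `E`-structure `J` on `H²(S(ℂ); ℂ)` of the projective K3
surface `S` is induced by an algebraic class of codimension `2` on `S ⊗ S`. `J` is a rational Hodge
endomorphism (`isOfHodgeType_map_of_cupSelfAdjoint`), hence `t • γ_*` for a rational `(2,2)`-class `γ`
(Voisin I Lemma 11.41, `exists_hodgeClass_corrAction_eq_smul_holds`, for the given orientation family),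
`γ` is algebraic by `HodgeConjectureFor 4 (S ⊗ S)`, and `J = (t⁻¹ • γ)_*`.
[cite: Varesco2023, §2 (p. 8)] [cite: VoisinHodgeI2002, §11.3.3 Thm. 11.38 and Lemma 11.41] -/
theorem eClassOfSquareHodge_proof :
    Summit.HodgeConjecture.HodgeConjecture.Theses.ELineTransport.EClassOfSquareHodge := by
  intro μ _hμ S hS m _hm J hJ hHC
  obtain ⟨hJrat, -, hJadj, hJ20⟩ := hJ
  have hJtyp := isOfHodgeType_map_of_cupSelfAdjoint hS.1 J hJrat hJadj (Real.sqrt m) hJ20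
  have hI := hodgePQ_independent_of_hodgeModel_holds
  obtain ⟨A⟩ := nonempty_hodgeModel_holds (n := 2) (X := S) hS.1
  -- Voisin I, Lemma 11.41: `J = t⁻¹ • γ_*` for a rational `(2,2)`-class `γ`
  obtain ⟨γ, hγQ, hγT, t, ht0, hγ⟩ := exists_hodgeClass_corrAction_eq_smul_holds hS.1 hS.1 A A
    (a := 2) (b := 2) (e := 2) (r := 0) (rfl : 2 + 2 * 2 = 2 + 2 * 2) (rfl : 2 + 0 = 2) J hJrat
    (fun p q _ c hc ↦ by
      rw [Nat.add_zero, Nat.add_zero]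
      exact (hI.isOfHodgeType_iff hS.1 A).1 (hJtyp p q c ((hI.isOfHodgeType_iff hS.1 A).2 hc))) μ
  -- `γ` is algebraic by the Hodge conjecture for `S ⊗ S` in codimension `2`
  have hγalg : γ ∈ algebraicClasses (S ⊗ S) 2 := hHC.2 2 γ hγQ hγT
  refine ⟨t⁻¹ • γ, Submodule.smul_mem _ _ hγalg, fun x ↦ ?_⟩
  have h := LinearMap.congr_fun hγ x
  rw [LinearMap.smul_apply, corrAction_apply] at h
  rw [map_smul, map_smul, h, smul_smul, inv_mul_cancel₀ ht0, one_smul]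

end Summit.HodgeConjecture.HodgeConjecture.Theorems.EClassOfSquareHodge

end
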